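import Summits.QuantumFields.YangMills.Theorems.FluctuationComparisonRegPrIntLS2BetaSqrtLRecursion
import HarnessLib

/-!
# The CONTRACTING sup recursion (ratio `r < 1`) and the DEFECT BUDGET of the variable-ratio `√L` recursion:
# `s_m = 0`, `s_t ≤ r·s_{t+1} + ρ_t` ⟹ `Σ_{t<m} s_t ≤ (Σ_{t<m} ρ_t)/(1 − r)` — which `s` feeds `ε_t` in
# `…S2BetaSqrtLRecursion.recursion_varRatio_sqrtL_le`, and why its `exp E` is depth-free

Width seat `ym3-torus-px16` (gen 20); `--kind proof --supports stmt-QuantumFields-20520 --as helper`, count-neutral,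
DEFINITION-FREE (0 `def`, 0 `instance`, 0 `notation`, default heartbeats).  Mathlib-only real-sequence algebra over
✓`…S2BetaSqrtLRecursion` §1 (the companion file reached the 400-line budget, hence a second file).

Bears on crux stmt-QuantumFields-20520 `FluctuationComparisonRegPrIntL`, LINE `semiclassical_s2beta`, registered
stub GAP♯∘ `stub_uniformFibreGapOrbit` through the depth-uniform flat letter `hFlat` (UV3-NODE §53–§54, §57, §63): the
telescoped road's nonlinear assembly (§57.8 (B)) is the recursion `B_t ≤ √L·(1 + ε_t)·B_{t+1} + R_t` with the flap
defect `ε_t = C·L·s′_{t+1}` (px12 g23's F₂ locate: the geodesic hat lift of a flat non-abelian field is not flat; the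
commutator is SIZE × ARC).  FINDING (px16 g20, 07:41Z): the SIZE there is the sup profile `s′` of the RELATIVE tower
`U′_t = I_t(U′_{t+1})·rel_t` — NOT the iterated-axial profile of ✓`…S2BetaIterAxialGaugeSup.dist1_iterAxialGauge_le`,
which is flat in the height (every level carries the top threshold `θBal(J+1)`, lit `T3UnitScaleTilt.histGood` puts
`θBal(K − j)` at height `j`, increasing in `j`) so that ITS `Σ_t s_t` is LINEAR in the depth `m = K − J`.  The relative
profile CONTRACTS: on comb bonds the hat lift divides arcs by `L` ((W3) of the hat lift), on the other bonds `rel_t` is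
flux-class (§57.8 (R2): the coarse bond cancels by conjugation), so `s′_m = 0`, `s′_t ≤ L⁻¹·s′_{t+1} + ρ_t` with
`Σ_t ρ_t` a threshold sum (✓`…S2BetaThresholdSum.thresholdSum_small`, depth-free).  This file is the algebra that turns
such a contracting recursion into the budget `Σ_{t<m} ε_t ≤ E` consumed by `recursion_varRatio_sqrtL_le`'s `hE`.

What is proved (all elementary):
* `recursion_contract_le_sum`: `s m = 0`, `s u ≤ r·s (u+1) + ρ u`, `0 ≤ r` ⟹ `s t ≤ Σ_{i < m−t} r^i·ρ (t+i)` (from §1 of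
  the companion);
* ★`sum_le_of_contract`: additionally `0 ≤ s 0`, `r < 1` ⟹ `Σ_{t<m} s t ≤ (Σ_{t<m} ρ t)/(1 − r)` (sum the inequalities;
  the shifted sum is the sum minus `s 0`); `sum_succ_le_of_contract` (the shifted sum `Σ_{t<m} s (t+1)`, the one `ε_t`
  uses); ★★`defect_budget_of_contract`: `Σ_{t<m} c·s (t+1) ≤ c·(Σ_{t<m} ρ t)/(1 − r)` (`0 ≤ c`);
* `inv_lt_one_and_budget_factor`: the `L⁻¹` instance, `1/(1 − L⁻¹) = L/(L − 1)`;
* §3 (UV3-NODE §64.4 «px16's §5 read upward») the UPWARD multiplicative layer of the (C)-assembly: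
  `upward_le_prod_mul(_of_lt)` (`F (t+1) ≤ q t·F t ⟹ F t ≤ (Π_{i<t} q i)·F 0`), ★★`upward_sqrtL_le`
  (`F (t+1) ≤ √L·(1 + η t)·F t`, `Ση ≤ H` ⟹ `F t ≤ exp H·(√L)^t·F 0` — the KEY LEMMA's `C·L^{t/2}` with `C = exp H`);
* ★★`recursion_varRatio_sqrtL_le_of_contract`: the two recursions COUPLED — energy `B t ≤ √L·(1 + c·s (t+1))·B (t+1) + R t`,
  sup `s t ≤ r·s (t+1) + ρ t` (`s m = 0`, `0 ≤ s`), `R t ≤ C·(√L)^t·F`, `Σ_{t<m} ρ t ≤ Sρ` ⟹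
  `B 0 ≤ exp (c·Sρ/(1 − r))·C·F·(L^m − 1)/(L − 1)` — depth enters only through `L^m`; the defect budget is the
  threshold sum, not the depth.

HONEST: real-sequence algebra; the identification of `ρ_t` with flux-class quantities and of `s` with the relative tower's
sup profile is the road's (§57.8) design on paper, NOT proved here; nothing of Bałaban's analysis is asserted or proved;
`hFlat`, GAP♯∘ (v11.4), S2β, crux 20520 and `YM3TorusSU2` are NOT proved; no registered stub is closed; rung R3 = SU(2)
YM₃ on T³ at fixed lattice data — NOT d = 4, NOT infinite volume, NOT a mass gap, NOT Clay; the Yang–Mills mass gap is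
NOT proved.  Sorry-free, axioms standard.

References: [Balaban1984PropagatorsI] Prop. 1.1 (1.89)–(1.90) p.33 (the quadratic floor this bookkeeping serves, at the
flat datum; locator per UV3-NODE §62); [Balaban1985RegularSpaces] Lemma 1 (1.24)–(1.26) pp.79–80 and p.87 before (1.65)
(the iterated axial gauge and its level profile).
-/

set_option autoImplicit false

open Finset
open scoped BigOperators

namespace Summit.QuantumFields.YangMills.Theorems.FluctuationComparisonRegPrIntLS2BetaContractingSupRecursion

open Summit.QuantumFields.YangMills.Theorems.FluctuationComparisonRegPrIntLS2BetaSqrtLRecursion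
  (recursion_le_pow_mul_add_sum recursion_varRatio_sqrtL_le prod_mul_one_add_le_pow_mul_exp_of_sum_le)

/-! ## §1. The contracting recursion, pointwise and summed -/

/-- the contracting recursion unrolled from height `t` to the top: `s m = 0`, `s u ≤ r·s (u+1) + ρ u` (`u < m`), `0 ≤ r`
⟹ `s t ≤ Σ_{i < m−t} r^i·ρ (t+i)`. [folklore] -/
theorem recursion_contract_le_sum (r : ℝ) (hr : 0 ≤ r) (s ρ : ℕ → ℝ) (m : ℕ) (hs : s m = 0)
    (hrec : ∀ u, u < m → s u ≤ r * s (u + 1) + ρ u) (t : ℕ) (ht : t ≤ m) :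
    s t ≤ ∑ i ∈ range (m - t), r ^ i * ρ (t + i) := by
  have h := recursion_le_pow_mul_add_sum r hr s ρ t (m - t) (fun u _ hu2 => hrec u (by omega))
  have e1 : t + (m - t) = m := by omega
  rw [e1, hs, mul_zero, zero_add] at h
  exact h

/-- ★ SUMMING A CONTRACTING RECURSION: `s m = 0`, `0 ≤ s 0`, `s t ≤ r·s (t+1) + ρ t` (`t < m`), `0 ≤ r < 1`
⟹ `Σ_{t<m} s t ≤ (Σ_{t<m} ρ t)/(1 − r)` — sum the inequalities; the shifted sum is the sum minus `s 0`. [folklore] -/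
theorem sum_le_of_contract (r : ℝ) (hr0 : 0 ≤ r) (hr1 : r < 1) (s ρ : ℕ → ℝ) (m : ℕ) (hs : s m = 0)
    (hs0 : 0 ≤ s 0) (hrec : ∀ t, t < m → s t ≤ r * s (t + 1) + ρ t) :
    ∑ t ∈ range m, s t ≤ (∑ t ∈ range m, ρ t) / (1 - r) := by
  have h1 : ∑ t ∈ range m, s t ≤ r * ∑ t ∈ range m, s (t + 1) + ∑ t ∈ range m, ρ t := by
    rw [Finset.mul_sum, ← Finset.sum_add_distrib]
    exact Finset.sum_le_sum fun t ht => hrec t (Finset.mem_range.mp ht)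
  have h2 : ∑ t ∈ range m, s (t + 1) = ∑ t ∈ range m, s t - s 0 := by
    have ha := Finset.sum_range_succ' s m
    have hb := Finset.sum_range_succ s m
    rw [hs] at hb
    linarith
  rw [h2] at h1
  have h3 : r * (∑ t ∈ range m, s t - s 0) ≤ r * ∑ t ∈ range m, s t := by
    have : r * s 0 ≥ 0 := mul_nonneg hr0 hs0
    nlinarith
  have h4 : (1 - r) * ∑ t ∈ range m, s t ≤ ∑ t ∈ range m, ρ t := by nlinarith
  have h1r : 0 < 1 - r := by linarith
  rw [le_div_iff₀ h1r, mul_comm]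
  exact h4

/-- the shifted sum (the one `ε_t` uses, built from `s (t+1)`): `Σ_{t<m} s (t+1) ≤ (Σ_{t<m} ρ t)/(1 − r)`. [folklore] -/
theorem sum_succ_le_of_contract (r : ℝ) (hr0 : 0 ≤ r) (hr1 : r < 1) (s ρ : ℕ → ℝ) (m : ℕ) (hs : s m = 0)
    (hs0 : 0 ≤ s 0) (hrec : ∀ t, t < m → s t ≤ r * s (t + 1) + ρ t) :
    ∑ t ∈ range m, s (t + 1) ≤ (∑ t ∈ range m, ρ t) / (1 - r) := by
  have h2 : ∑ t ∈ range m, s (t + 1) = ∑ t ∈ range m, s t - s 0 := by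
    have ha := Finset.sum_range_succ' s m
    have hb := Finset.sum_range_succ s m
    rw [hs] at hb
    linarith
  have h := sum_le_of_contract r hr0 hr1 s ρ m hs hs0 hrec
  rw [h2]
  linarith

/-- ★★ THE DEFECT BUDGET: with `ε t := c·s (t+1)` (`0 ≤ c`), a contracting sup profile (`s m = 0`, `0 ≤ s 0`,
`s t ≤ r·s (t+1) + ρ t`, `0 ≤ r < 1`) gives `Σ_{t<m} c·s (t+1) ≤ c·(Σ_{t<m} ρ t)/(1 − r)`.  In the road: `r = L⁻¹`,
`c = C·L`, `Σρ ≤` the depth-free threshold sum. [folklore] -/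
theorem defect_budget_of_contract (r : ℝ) (hr0 : 0 ≤ r) (hr1 : r < 1) (s ρ : ℕ → ℝ) (m : ℕ) (hs : s m = 0)
    (hs0 : 0 ≤ s 0) (hrec : ∀ t, t < m → s t ≤ r * s (t + 1) + ρ t) (c : ℝ) (hc : 0 ≤ c) :
    ∑ t ∈ range m, c * s (t + 1) ≤ c * ((∑ t ∈ range m, ρ t) / (1 - r)) := by
  rw [← Finset.mul_sum]
  exact mul_le_mul_of_nonneg_left (sum_succ_le_of_contract r hr0 hr1 s ρ m hs hs0 hrec) hc

/-- the `L⁻¹` instance: for `1 < L`, `0 ≤ L⁻¹ < 1` and `1/(1 − L⁻¹) = L/(L − 1)`. [folklore] -/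
theorem inv_lt_one_and_budget_factor (L : ℝ) (hL : 1 < L) :
    0 ≤ L⁻¹ ∧ L⁻¹ < 1 ∧ 1 / (1 - L⁻¹) = L / (L - 1) := by
  have hL0 : 0 < L := by linarith
  refine ⟨inv_nonneg.mpr hL0.le, inv_lt_one_of_one_lt₀ hL, ?_⟩
  have hL1 : L - 1 ≠ 0 := by linarith
  field_simp

/-! ## §2. The two recursions coupled -/

/-- ★★ THE COUPLED RECURSIONS OF THE TELESCOPED ROAD: energy `B t ≤ √L·(1 + c·s (t+1))·B (t+1) + R t` (`B m = 0`), sup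
`s t ≤ r·s (t+1) + ρ t` (`s m = 0`, `0 ≤ s`, `0 ≤ r < 1`, `0 ≤ ρ` summed to `≤ Sρ`), `R t ≤ C·(√L)^t·F` (`0 ≤ c, C, F`,
`1 < L`) ⟹ `B 0 ≤ exp (c·(Sρ/(1 − r)))·C·F·(L^m − 1)/(L − 1)`: DEPTH enters only through `L^m`; the defect budget is the
threshold sum `Sρ`, never the depth. [folklore] -/
theorem recursion_varRatio_sqrtL_le_of_contract (L : ℝ) (hL : 1 < L) (B R s ρ : ℕ → ℝ) (m : ℕ)
    (hB : B m = 0) (hs : s m = 0) (hsnn : ∀ t, 0 ≤ s t) (r : ℝ) (hr0 : 0 ≤ r) (hr1 : r < 1)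
    (hsrec : ∀ t, t < m → s t ≤ r * s (t + 1) + ρ t) (Sρ : ℝ) (hρ : ∑ t ∈ range m, ρ t ≤ Sρ)
    (c : ℝ) (hc : 0 ≤ c)
    (hrec : ∀ t, t < m → B t ≤ Real.sqrt L * (1 + c * s (t + 1)) * B (t + 1) + R t) (C F : ℝ) (hC : 0 ≤ C)
    (hF : 0 ≤ F) (hR : ∀ t, t < m → R t ≤ C * Real.sqrt L ^ t * F) :
    B 0 ≤ Real.exp (c * (Sρ / (1 - r))) * C * F * ((L ^ m - 1) / (L - 1)) := by
  have h1r : 0 < 1 - r := by linarith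
  -- the defect budget `E := c·Sρ/(1−r)`
  have hE : ∑ t ∈ range m, c * s (t + 1) ≤ c * (Sρ / (1 - r)) := by
    refine (defect_budget_of_contract r hr0 hr1 s ρ m hs (hsnn 0) hsrec c hc).trans ?_
    exact mul_le_mul_of_nonneg_left (div_le_div_of_nonneg_right hρ h1r.le) hc
  exact recursion_varRatio_sqrtL_le L hL B R (fun t => c * s (t + 1)) m hB
    (fun t => mul_nonneg hc (hsnn (t + 1))) (c * (Sρ / (1 - r))) hE hrec C F hC hF hR

/-! ## §3. The UPWARD multiplicative layer of the (C)-assembly (UV3-NODE §64.2∕§64.4: «px16's §5 read upward»)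

The nonabelian KEY LEMMA's level step is `‖f^{(t+1)}‖ ≤ q_t·‖f^{(t)}‖` with `q_t = √L·(1 + η_t)`,
`η_t = C·θ_t + ε_t/√L` summable; hence `‖f^{(t)}‖ ≤ (√L)^t·exp(Σ η)·‖f^{(0)}‖` — the `C·L^{t/2}·‖f‖` input `hR`∕`hφ` of
the energy recursion. -/

/-- the upward multiplicative recursion: `F (t+1) ≤ q t·F t` (`0 ≤ q`, `0 ≤ F 0`) ⟹ `F t ≤ (Π_{i<t} q i)·F 0`. [folklore] -/
theorem upward_le_prod_mul (q F : ℕ → ℝ) (hq : ∀ t, 0 ≤ q t) (hrec : ∀ t, F (t + 1) ≤ q t * F t) :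
    ∀ t, F t ≤ (∏ i ∈ range t, q i) * F 0 := by
  intro t
  induction t with
  | zero => simp
  | succ t ih =>
    rw [Finset.prod_range_succ]
    calc F (t + 1) ≤ q t * F t := hrec t
      _ ≤ q t * ((∏ i ∈ range t, q i) * F 0) := mul_le_mul_of_nonneg_left ih (hq t)
      _ = (∏ i ∈ range t, q i) * q t * F 0 := by ring

/-- the same on a finite range of levels `t ≤ m` (hypothesis only for `t < m`). [folklore] -/
theorem upward_le_prod_mul_of_lt (q F : ℕ → ℝ) (m : ℕ) (hq : ∀ t, 0 ≤ q t)
    (hrec : ∀ t, t < m → F (t + 1) ≤ q t * F t) : ∀ t, t ≤ m → F t ≤ (∏ i ∈ range t, q i) * F 0 := by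
  intro t
  induction t with
  | zero => intro _; simp
  | succ t ih =>
    intro ht
    rw [Finset.prod_range_succ]
    calc F (t + 1) ≤ q t * F t := hrec t (by omega)
      _ ≤ q t * ((∏ i ∈ range t, q i) * F 0) := mul_le_mul_of_nonneg_left (ih (by omega)) (hq t)
      _ = (∏ i ∈ range t, q i) * q t * F 0 := by ring

/-- ★★ THE KEY LEMMA's CONSTANT FROM THE LEVEL STEP: `F (t+1) ≤ √L·(1 + η t)·F t` for `t < m` with `0 ≤ η`,
`Σ_{t<m} η t ≤ H`, `0 ≤ F 0` ⟹ `F t ≤ exp H·(√L)^t·F 0` for every `t ≤ m` — i.e. `‖f^{(t)}‖ ≤ C·L^{t/2}·‖f‖`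
with `C = exp H` depth-free (the `hφ`∕`hR` input of `recursion_sqrtL_two_term` ∕ `recursion_varRatio_sqrtL_le`). [folklore] -/
theorem upward_sqrtL_le (L : ℝ) (F η : ℕ → ℝ) (m : ℕ) (hF0 : 0 ≤ F 0) (hη : ∀ t, 0 ≤ η t)
    (H : ℝ) (hH : ∑ t ∈ range m, η t ≤ H)
    (hrec : ∀ t, t < m → F (t + 1) ≤ Real.sqrt L * (1 + η t) * F t) :
    ∀ t, t ≤ m → F t ≤ Real.exp H * Real.sqrt L ^ t * F 0 := by
  intro t ht
  have hq : ∀ t, 0 ≤ Real.sqrt L * (1 + η t) := fun t =>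
    mul_nonneg (Real.sqrt_nonneg L) (by linarith [hη t])
  have h1 := upward_le_prod_mul_of_lt (fun t => Real.sqrt L * (1 + η t)) F m hq hrec t ht
  have h2 : ∏ i ∈ range t, Real.sqrt L * (1 + η i) ≤ Real.sqrt L ^ t * Real.exp H :=
    prod_mul_one_add_le_pow_mul_exp_of_sum_le (Real.sqrt L) (Real.sqrt_nonneg L) η hη m H hH t ht
  calc F t ≤ (∏ i ∈ range t, Real.sqrt L * (1 + η i)) * F 0 := h1
    _ ≤ (Real.sqrt L ^ t * Real.exp H) * F 0 := mul_le_mul_of_nonneg_right h2 hF0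
    _ = Real.exp H * Real.sqrt L ^ t * F 0 := by ring

/-! ## §4. The BOOTSTRAP of the sup recursion with a quadratic term and a chart guard (v1.2 append; px17 g19's
CONDITIONAL-STEP spec 08:12Z for `…RelativeTowerSupProfile`)

The lattice gives the one-level sup step only under the chart guard at the COARSER level and with a quadratic
(SIZE × SIZE) term: `s (t+1) ≤ σ₀ → s t ≤ r₀·s (t+1) + ρ t + C₂·s (t+1)²`.  With `Σρ ≤ Sρ` small
(`X := 2Sρ/(1−r₀) ≤ σ₀`, `C₂·X ≤ (1−r₀)/2`) a downward induction keeps every level `≤ X` (hence inside the guard) and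
LINEARISES the step to `s t ≤ r·s (t+1) + ρ t` with the constant ratio `r = r₀ + C₂·X ≤ (1+r₀)/2 < 1` — the premise
`hsrec` of §1–§2. -/

/-- `0 ≤ ρ` and `Σ_{t<m} ρ t ≤ Sρ` give the uniform bound `ρ t ≤ Sρ` for `t < m` (and `0 ≤ Sρ`). [folklore] -/
theorem le_of_sum_le_of_nonneg (ρ : ℕ → ℝ) (m : ℕ) (Sρ : ℝ) (hρ : ∀ t, 0 ≤ ρ t)
    (hSρ : ∑ t ∈ range m, ρ t ≤ Sρ) (t : ℕ) (ht : t < m) : ρ t ≤ Sρ :=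
  (Finset.single_le_sum (f := ρ) (fun i _ => hρ i) (Finset.mem_range.mpr ht)).trans hSρ

/-- ★ SUP BOOTSTRAP (conditional step): `s m = 0`, `0 ≤ s`, `0 ≤ ρ`, `Σ_{t<m} ρ t ≤ Sρ`,
`∀ t < m, s (t+1) ≤ σ₀ → s t ≤ r₀·s (t+1) + ρ t + C₂·s (t+1)²`, `0 ≤ r₀ < 1`, `0 ≤ C₂`, and the smallness
`2Sρ/(1−r₀) ≤ σ₀`, `C₂·(2Sρ/(1−r₀)) ≤ (1−r₀)/2` ⟹ `s t ≤ 2Sρ/(1−r₀)` at EVERY level `t ≤ m` (downward induction on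
the codepth; the guard is re-established at each level; depth-free). [folklore] -/
theorem sup_bootstrap (s ρ : ℕ → ℝ) (m : ℕ) (r₀ C₂ σ₀ Sρ : ℝ) (hs : s m = 0) (hsnn : ∀ t, 0 ≤ s t)
    (hρ : ∀ t, 0 ≤ ρ t) (hSρ : ∑ t ∈ range m, ρ t ≤ Sρ)
    (hstep : ∀ t, t < m → s (t + 1) ≤ σ₀ → s t ≤ r₀ * s (t + 1) + ρ t + C₂ * s (t + 1) ^ 2)
    (hr0 : 0 ≤ r₀) (hr1 : r₀ < 1) (hC : 0 ≤ C₂)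
    (hsmall₁ : 2 * Sρ / (1 - r₀) ≤ σ₀) (hsmall₂ : C₂ * (2 * Sρ / (1 - r₀)) ≤ (1 - r₀) / 2) :
    ∀ t, t ≤ m → s t ≤ 2 * Sρ / (1 - r₀) := by
  have h1r : 0 < 1 - r₀ := by linarith
  have hSρ0 : 0 ≤ Sρ := (Finset.sum_nonneg fun i _ => hρ i).trans hSρ
  set X : ℝ := 2 * Sρ / (1 - r₀) with hX
  have hX0 : 0 ≤ X := div_nonneg (by linarith) h1r.le
  suffices h : ∀ k, ∀ t, t + k = m → s t ≤ X by
    intro t ht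
    exact h (m - t) t (by omega)
  intro k
  induction k with
  | zero =>
    intro t ht
    have htm : t = m := by omega
    rw [htm, hs]
    exact hX0
  | succ k ih =>
    intro t ht
    have ht' : t < m := by omega
    have hS : s (t + 1) ≤ X := ih (t + 1) (by omega)
    have hS0 : 0 ≤ s (t + 1) := hsnn (t + 1)
    have hguard : s (t + 1) ≤ σ₀ := hS.trans hsmall₁
    have h1 : r₀ * s (t + 1) ≤ r₀ * X := mul_le_mul_of_nonneg_left hS hr0
    have h2 : s (t + 1) ^ 2 ≤ X * X := by nlinarith
    have h3 : C₂ * s (t + 1) ^ 2 ≤ C₂ * (X * X) := mul_le_mul_of_nonneg_left h2 hC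
    have h4 : C₂ * (X * X) ≤ (1 - r₀) / 2 * X := by
      have : C₂ * X ≤ (1 - r₀) / 2 := hsmall₂
      nlinarith
    have h5 : r₀ * X + Sρ + (1 - r₀) / 2 * X = X := by
      rw [hX]
      field_simp
      ring
    calc s t ≤ r₀ * s (t + 1) + ρ t + C₂ * s (t + 1) ^ 2 := hstep t ht' hguard
      _ ≤ r₀ * X + Sρ + (1 - r₀) / 2 * X := by
          linarith [le_of_sum_le_of_nonneg ρ m Sρ hρ hSρ t ht']
      _ = X := h5

/-- ★★ THE LINEARISED RECURSION AFTER THE BOOTSTRAP: under the hypotheses of `sup_bootstrap` the quadratic,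
guarded step implies the plain contracting step `s t ≤ r·s (t+1) + ρ t` with the CONSTANT ratio
`r := r₀ + C₂·(2Sρ/(1−r₀))`, `0 ≤ r < 1` (indeed `r ≤ (1+r₀)/2`) — EXACTLY the premise `hsrec` of
`sum_le_of_contract` ∕ `recursion_varRatio_sqrtL_le_of_contract`. [folklore] -/
theorem linearised_of_bootstrap (s ρ : ℕ → ℝ) (m : ℕ) (r₀ C₂ σ₀ Sρ : ℝ) (hs : s m = 0)
    (hsnn : ∀ t, 0 ≤ s t) (hρ : ∀ t, 0 ≤ ρ t) (hSρ : ∑ t ∈ range m, ρ t ≤ Sρ)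
    (hstep : ∀ t, t < m → s (t + 1) ≤ σ₀ → s t ≤ r₀ * s (t + 1) + ρ t + C₂ * s (t + 1) ^ 2)
    (hr0 : 0 ≤ r₀) (hr1 : r₀ < 1) (hC : 0 ≤ C₂)
    (hsmall₁ : 2 * Sρ / (1 - r₀) ≤ σ₀) (hsmall₂ : C₂ * (2 * Sρ / (1 - r₀)) ≤ (1 - r₀) / 2) :
    0 ≤ r₀ + C₂ * (2 * Sρ / (1 - r₀)) ∧ r₀ + C₂ * (2 * Sρ / (1 - r₀)) < 1 ∧
      ∀ t, t < m → s t ≤ (r₀ + C₂ * (2 * Sρ / (1 - r₀))) * s (t + 1) + ρ t := by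
  have h1r : 0 < 1 - r₀ := by linarith
  have hSρ0 : 0 ≤ Sρ := (Finset.sum_nonneg fun i _ => hρ i).trans hSρ
  set X : ℝ := 2 * Sρ / (1 - r₀) with hX
  have hX0 : 0 ≤ X := div_nonneg (by linarith) h1r.le
  refine ⟨by positivity, by nlinarith, fun t ht => ?_⟩
  have hS : s (t + 1) ≤ X :=
    sup_bootstrap s ρ m r₀ C₂ σ₀ Sρ hs hsnn hρ hSρ hstep hr0 hr1 hC hsmall₁ hsmall₂ (t + 1) (by omega)
  have hS0 : 0 ≤ s (t + 1) := hsnn (t + 1)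
  have hguard : s (t + 1) ≤ σ₀ := hS.trans hsmall₁
  have h2 : C₂ * s (t + 1) ^ 2 ≤ C₂ * X * s (t + 1) := by
    have : s (t + 1) ^ 2 ≤ X * s (t + 1) := by nlinarith
    nlinarith
  calc s t ≤ r₀ * s (t + 1) + ρ t + C₂ * s (t + 1) ^ 2 := hstep t ht hguard
    _ ≤ r₀ * s (t + 1) + ρ t + C₂ * X * s (t + 1) := by linarith
    _ = (r₀ + C₂ * X) * s (t + 1) + ρ t := by ring

/-- ★★★ THE ENDPOINT BY ONE `exact` (§2 ∘ §4): the guarded quadratic sup step + the energy recursion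
`B t ≤ √L·(1 + c·s (t+1))·B (t+1) + R t` (`B m = 0`, `R t ≤ C·(√L)^t·F`) give
`B 0 ≤ exp (c·(Sρ/(1 − r)))·C·F·(L^m − 1)/(L − 1)` with `r := r₀ + C₂·(2Sρ/(1−r₀))` — depth-free constant,
depth only through `L^m`. [folklore] -/
theorem recursion_varRatio_sqrtL_le_of_condStep (L : ℝ) (hL : 1 < L) (B R s ρ : ℕ → ℝ) (m : ℕ)
    (hB : B m = 0) (hs : s m = 0) (hsnn : ∀ t, 0 ≤ s t) (hρ : ∀ t, 0 ≤ ρ t) (r₀ C₂ σ₀ Sρ : ℝ)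
    (hSρ : ∑ t ∈ range m, ρ t ≤ Sρ)
    (hstep : ∀ t, t < m → s (t + 1) ≤ σ₀ → s t ≤ r₀ * s (t + 1) + ρ t + C₂ * s (t + 1) ^ 2)
    (hr0 : 0 ≤ r₀) (hr1 : r₀ < 1) (hC₂ : 0 ≤ C₂)
    (hsmall₁ : 2 * Sρ / (1 - r₀) ≤ σ₀) (hsmall₂ : C₂ * (2 * Sρ / (1 - r₀)) ≤ (1 - r₀) / 2)
    (c : ℝ) (hc : 0 ≤ c)
    (hrec : ∀ t, t < m → B t ≤ Real.sqrt L * (1 + c * s (t + 1)) * B (t + 1) + R t) (C F : ℝ) (hC : 0 ≤ C)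
    (hF : 0 ≤ F) (hR : ∀ t, t < m → R t ≤ C * Real.sqrt L ^ t * F) :
    B 0 ≤ Real.exp (c * (Sρ / (1 - (r₀ + C₂ * (2 * Sρ / (1 - r₀)))))) * C * F * ((L ^ m - 1) / (L - 1)) := by
  obtain ⟨hr0', hr1', hsrec⟩ :=
    linearised_of_bootstrap s ρ m r₀ C₂ σ₀ Sρ hs hsnn hρ hSρ hstep hr0 hr1 hC₂ hsmall₁ hsmall₂
  exact recursion_varRatio_sqrtL_le_of_contract L hL B R s ρ m hB hs hsnn _ hr0' hr1' hsrec Sρ hSρ c hc hrec C F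
    hC hF hR

end Summit.QuantumFields.YangMills.Theorems.FluctuationComparisonRegPrIntLS2BetaContractingSupRecursion
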